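import Literature.Topology.FourManifolds.CircleSurgeryExistence
import Literature.Topology.FourManifolds.DehnSurgery
import Literature.Topology.FourManifolds.GluckTwistProofs
import HarnessLib

/-!
# Dehn surgery along a tube in a 3-manifold: the relational predicate and the construction

Topic `Literature/Topology/FourManifolds` (fact seat
`provefact-Literature.SPC4.exists_isIntegralSurgeryLink`, the Lickorish–Wallace theorem, step **F4** of
`LickorishWallace.lean`: Lickorish's surgery realisation of Dehn twists).

Lickorish, *A representation of orientable combinatorial 3-manifolds*, Ann. of Math. 76 (1962),
proof of Thm. 2 (p. 539, Fig. 11) performs a `C`-homeomorphism (Dehn twist) of the boundary of a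
handlebody `T₁` "at the expense of cutting a solid torus out of the interior of `T₁`, and having to
sew it back differently", and iterates, the toral holes being inserted one after the other into the
successively modified manifold; Schultens, *Introduction to 3-Manifolds* (2014), Lemma 7.3.4 is the
smooth form (a Dehn twist in the gluing map of a Heegaard splitting is a Dehn surgery on the curve
pushed into the handlebody). To formalise the iteration one needs Dehn surgery along a solid torus
in an **arbitrary** 3-manifold `X` (not only in `S³`, which is what `Literature.Topology.FourManifolds.IsIntegralSurgery` of
`DehnSurgery.lean` provides). This file supplies it, in the relational open-gluing language of the
tree (Rolfsen, *Knots and Links* (1976), §9.F "surgery on a 3-manifold along a solid torus";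
Gompf–Stipsicz (1999), §5.3), exactly parallel to the one-dimension-higher `Literature.Topology.FourManifolds.CircleNbhd`,
`Literature.Topology.FourManifolds.circleSurgeryRel` of `CircleSurgery.lean` and to the construction of
`CircleSurgeryExistence.lean`, which is ported here line by line:

* `Literature.TubeNbhd IX c` — a **tube**: an open smooth embedding `ν : 𝕊¹ × ℝ² ↪ X` with zero section
  the circle `c : 𝕊¹ → X` (for `X = 𝕊³` an oriented tubular neighbourhood `Literature.Topology.FourManifolds.Knot.TubularNbhd`
  of a knot is one: `Literature.Topology.FourManifolds.Knot.TubularNbhd.toTubeNbhd`; in a 3-manifold charted on `ℝ³` openness of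
  the range is automatic, `Literature.Topology.FourManifolds.TubeNbhd.ofEmbedding`);
* `Literature.tubeSurgeryRel ν a b` — the **surgery relation** between `X ∖ c(𝕊¹)` and the open solid
  torus `D̊² × 𝕊¹` (`Literature.Topology.FourManifolds.solidTorus`): `a = ν (u, t • v) ∼ b = (t • u, v)`, `0 < t < 1`; for
  `ν = ν₀.toTubeNbhd` it is `Literature.surgeryRel ν₀` on the nose (`Literature.Topology.FourManifolds.tubeSurgeryRel_toTubeNbhd`), so
  that the meridian discs of the new solid torus are glued to the longitudes (push-offs) of `ν`;
* the **construction** of the surgered manifold `ν.Surgered = (X ∖ c) ∪_glue (D̊² × 𝕊¹)` as the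
  pushout `Literature.Topology.FourManifolds.SmoothGlueData.Glued` (`GluingConstruction.lean`) along the polar identification
  `ν (u, w) ↦ (‖w‖ • u, w/‖w‖)`, `0 < ‖w‖ < 1`, whose graph is `tubeSurgeryRel ν`
  (`TubeNbhd.tubeSurgeryRel_iff`); it is Hausdorff (`TubeNbhd.isClosed_graph`: the graph is the
  trace of the compact set `𝕊¹ × [0, 1] × 𝕊¹`), compact (cover by `X ∖ ν(𝕊¹ × ½B²)` and
  `½D² × 𝕊¹`) and second countable, and an open gluing with the explicit witnesses `inl`, `inr`
  (`TubeNbhd.isOpenGluingWith_surgered`, `TubeNbhd.surgery_exists`);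
* as a corollary, the named fact `Literature.Topology.FourManifolds.exists_isIntegralSurgery` of `DehnSurgery.lean` (existence
  of `m`-surgery on a knot in `S³` as a closed smooth 3-manifold) is reduced to the existence of a
  tubular neighbourhood with the prescribed framing (`Literature.Topology.FourManifolds.exists_isIntegralSurgery_of`).

Everything in this file is proved.

## References

* W. B. R. Lickorish, Ann. of Math. 76 (1962), 531–540, proof of Thm. 2, p. 539 and Fig. 11.
  [LickorishAnnals1962]
* D. Rolfsen, *Knots and Links* (1976), §9.F. [Rolfsen1976]
* R. Gompf, A. Stipsicz, *4-Manifolds and Kirby Calculus* (1999), §5.3. [GompfStipsicz1999]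
* J. Schultens, *Introduction to 3-Manifolds*, GSM 151 (2014), Lemma 7.3.4. [Schultens2014]
* A. Kosinski, *Differential Manifolds* (1993), VI.1–2. [Kosinski1993]
-/

open scoped Manifold ContDiff Topology
open Set Function Metric

noncomputable section

namespace Literature.Topology.FourManifolds

universe u

/-- Local notation: `𝔼 n` is the model Euclidean space `EuclideanSpace ℝ (Fin n)`. -/
local notation "𝔼 " n:arg => EuclideanSpace ℝ (Fin n)

/-- Local notation: `𝕊 n` is the unit sphere in `EuclideanSpace ℝ (Fin (n + 1))`. -/
local notation "𝕊 " n:arg => (Metric.sphere (0 : EuclideanSpace ℝ (Fin (n + 1))) 1)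

attribute [local instance] fact_finrank_euclideanSpace_succ

/-! ### Tubes and the surgery relation -/

section Defs

variable {EX HX : Type*} [NormedAddCommGroup EX] [NormedSpace ℝ EX] [TopologicalSpace HX]
  (IX : ModelWithCorners ℝ EX HX) {X : Type*} [TopologicalSpace X] [ChartedSpace HX X]

/-- A **tube** around a circle `c : 𝕊 1 → X` in a manifold `X` (of dimension `3` in all
applications): a `C^∞` open embedding `𝕊 1 × ℝ² ↪ X` whose zero section is `c` — a trivialised
open tubular neighbourhood, i.e. a parametrised open solid torus `ν(𝕊¹ × D̊²)` with core `c`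
together with its open collar `ν(𝕊¹ × (ℝ² ∖ D̊²))`. The analogue of `Literature.Topology.FourManifolds.CircleNbhd` (circles in
4-manifolds) one dimension down; an oriented tubular neighbourhood of a knot in `S³`
(`Literature.Topology.FourManifolds.Knot.TubularNbhd`) is one (`Knot.TubularNbhd.toTubeNbhd`). Rolfsen, *Knots and Links*
(1976), §9.F ("let `M` be a 3-manifold and `V ⊆ M` a solid torus"); Lickorish (1962), p. 539.
[cite: Rolfsen1976, §9.F] -/
structure TubeNbhd (c : 𝕊 1 → X) where
  /-- The embedding `𝕊 1 × ℝ² → X`. -/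
  toFun : (𝕊 1) × (𝔼 2) → X
  /-- The map is a `C^∞` embedding. -/
  isSmoothEmbedding : Manifold.IsSmoothEmbedding ((𝓡 1).prod 𝓘(ℝ, 𝔼 2)) IX ∞ toFun
  /-- The image is open. -/
  isOpen_range : IsOpen (Set.range toFun)
  /-- The zero section is the circle `c`. -/
  apply_zero : ∀ u, toFun (u, 0) = c u

namespace TubeNbhd

variable {IX} {c : 𝕊 1 → X}

/-- A tube is an open embedding. [folklore] -/
protected theorem isOpenEmbedding (ν : TubeNbhd IX c) : Topology.IsOpenEmbedding ν.toFun :=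
  ⟨ν.isSmoothEmbedding.isEmbedding, ν.isOpen_range⟩

/-- A tube is injective. [folklore] -/
protected theorem injective (ν : TubeNbhd IX c) : Injective ν.toFun := ν.isSmoothEmbedding.isEmbedding.injective

/-- A tube is smooth. [folklore] -/
protected theorem contMDiff (ν : TubeNbhd IX c) : ContMDiff ((𝓡 1).prod 𝓘(ℝ, 𝔼 2)) IX ∞ ν.toFun :=
  ν.isSmoothEmbedding.contMDiff

/-- A tube is continuous. [folklore] -/
protected theorem continuous (ν : TubeNbhd IX c) : Continuous ν.toFun :=
  ν.isSmoothEmbedding.isEmbedding.continuous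

/-- The core circle `c = ν ∘ (·, 0)` of a tube is continuous. [folklore] -/
theorem continuous_curve (ν : TubeNbhd IX c) : Continuous c := by
  have : c = ν.toFun ∘ fun u ↦ (u, 0) := funext fun u ↦ (ν.apply_zero u).symm
  rw [this]
  exact ν.continuous.comp (by fun_prop)

/-- The image of the core circle is closed (`X` Hausdorff). [folklore] -/
theorem isClosed_range_curve [T2Space X] (ν : TubeNbhd IX c) : IsClosed (Set.range c) :=
  (isCompact_range ν.continuous_curve).isClosed

/-- `ν (u, w)` lies on the core circle iff `w = 0`. [folklore] -/
theorem apply_mem_range_iff (ν : TubeNbhd IX c) {u : 𝕊 1} {w : 𝔼 2} :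
    ν.toFun (u, w) ∈ range c ↔ w = 0 := by
  constructor
  · rintro ⟨u', h⟩
    rw [← ν.apply_zero] at h
    exact (Prod.ext_iff.1 (ν.injective h)).2.symm
  · rintro rfl; exact ⟨u, (ν.apply_zero u).symm⟩

/-- The **complement of the core circle** `X ∖ c(𝕊 1)`, an open submanifold of `X`; the first piece
of the surgery gluing. Rolfsen (1976), §9.F. [cite: Rolfsen1976, §9.F] -/
def complement [T2Space X] (ν : TubeNbhd IX c) : TopologicalSpace.Opens X :=
  ⟨(Set.range c)ᶜ, ν.isClosed_range_curve.isOpen_compl⟩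

/-- Membership in the complement of the core circle. [folklore] -/
@[simp] theorem mem_complement_iff [T2Space X] (ν : TubeNbhd IX c) (x : X) :
    x ∈ ν.complement ↔ x ∉ Set.range c :=
  Iff.rfl

end TubeNbhd

variable {IX} in
/-- The **surgery relation of a tube** `ν` around `c`, between `X ∖ c(𝕊 1)` and the open solid
torus `D̊² × 𝕊 1` (`Literature.Topology.FourManifolds.solidTorus`): the point `a` of `X ∖ c` is glued to `b = (w, v)` iff
`w = t • u` and `a = ν (u, t • v)` for some `u ∈ 𝕊 1`, `0 < t < 1`. Thus the punctured meridian
discs `{(t • u, v₀)}` of the new solid torus are glued onto the punctured annuli `{ν (u, t • v₀)}`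
bounded by the longitudes `u ↦ ν (u, v₀)` of `ν`, and its longitudes onto the meridians of `ν`:
the solid torus `ν(𝕊¹ × D²)` is removed and sewn back with meridian and longitude exchanged
("sewn back differently", Lickorish (1962), p. 539; Rolfsen (1976), §9.F; it is the relation
`Literature.Topology.FourManifolds.Knot.TubularNbhd.glueRel` of `DehnSurgery.lean` for tubes in a general `X`, see
`tubeSurgeryRel_toTubeNbhd`). [cite: Rolfsen1976, §9.F] -/
def tubeSurgeryRel {c : 𝕊 1 → X} (ν : TubeNbhd IX c) (a : ↥(Set.range c)ᶜ) (b : ↥solidTorus) :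
    Prop :=
  ∃ (u : 𝕊 1) (t : ℝ), t ∈ Set.Ioo (0 : ℝ) 1 ∧ (b : (𝔼 2) × (𝕊 1)).1 = t • (u : 𝔼 2) ∧
    (a : X) = ν.toFun (u, t • ((b : (𝔼 2) × (𝕊 1)).2 : 𝔼 2))

end Defs

/-! ### Tubes in `S³` and in 3-manifolds charted on `ℝ³` -/

section Sphere

/-- **An oriented tubular neighbourhood of a knot is a tube** around the knot: its range is open by
invariance of domain (`Manifold.IsSmoothEmbedding.isOpenMap_of_finrank_eq`, `1 + 2 = 3`).
Hirsch (1976), §4.5. [cite: Hirsch1976, §4.5] -/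
def Knot.TubularNbhd.toTubeNbhd {K : 𝕊 1 → 𝕊 3} (ν : Knot.TubularNbhd K) : TubeNbhd (𝓡 3) K where
  toFun := ν
  isSmoothEmbedding := ν.isSmoothEmbedding_coe
  isOpen_range := (Manifold.IsSmoothEmbedding.isOpenMap_of_finrank_eq ν.isSmoothEmbedding_coe
    (by simp)).isOpen_range
  apply_zero := ν.apply_zero

/-- The tube of a tubular neighbourhood is the tubular neighbourhood as a function. [folklore] -/
@[simp] theorem Knot.TubularNbhd.toTubeNbhd_toFun {K : 𝕊 1 → 𝕊 3} (ν : Knot.TubularNbhd K) :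
    ν.toTubeNbhd.toFun = ⇑ν := rfl

/-- The complement of the core of the tube of a tubular neighbourhood of a knot is the knot
complement. [folklore] -/
theorem Knot.TubularNbhd.toTubeNbhd_complement {K : Knot} (ν : Knot.TubularNbhd K) :
    ν.toTubeNbhd.complement = K.complement := rfl

/-- **The tube surgery relation of a tubular neighbourhood of a knot is the Dehn surgery relation**
`Literature.Topology.FourManifolds.surgeryRel` of `DehnSurgery.lean` (definitionally). [folklore] -/
theorem tubeSurgeryRel_toTubeNbhd {K : Knot} (ν : Knot.TubularNbhd K) (a : ↥K.complement)
    (b : ↥solidTorus) : tubeSurgeryRel ν.toTubeNbhd a b ↔ surgeryRel ν a b := Iff.rfl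

/-- **A smooth embedding `𝕊 1 × ℝ² ↪ X` into a 3-manifold charted on `ℝ³` is a tube** around its
zero section (openness of the range by invariance of domain). [folklore] -/
def TubeNbhd.ofEmbedding {X : Type*} [TopologicalSpace X] [ChartedSpace (𝔼 3) X]
    (e : (𝕊 1) × (𝔼 2) → X) (he : Manifold.IsSmoothEmbedding ((𝓡 1).prod 𝓘(ℝ, 𝔼 2)) (𝓡 3) ∞ e) :
    TubeNbhd (𝓡 3) (fun u ↦ e (u, 0)) where
  toFun := e
  isSmoothEmbedding := he
  isOpen_range := (Manifold.IsSmoothEmbedding.isOpenMap_of_finrank_eq he (by simp)).isOpen_range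
  apply_zero _ := rfl

/-- The tube of an embedding is the embedding. [folklore] -/
@[simp] theorem TubeNbhd.ofEmbedding_toFun {X : Type*} [TopologicalSpace X] [ChartedSpace (𝔼 3) X]
    (e : (𝕊 1) × (𝔼 2) → X) (he : Manifold.IsSmoothEmbedding ((𝓡 1).prod 𝓘(ℝ, 𝔼 2)) (𝓡 3) ∞ e) :
    (TubeNbhd.ofEmbedding e he).toFun = e := rfl

end Sphere

/-! ### The gluing datum of a tube surgery -/

section Datum

variable {X : Type u} [TopologicalSpace X] [ChartedSpace (𝔼 3) X] {c : 𝕊 1 → X}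
  (ν : TubeNbhd (𝓡 3) c)

namespace TubeNbhd

/-- The tube as an open partial homeomorphism `𝕊¹ × ℝ² ⇀ X` (source `univ`, target `range ν`).
[folklore] -/
def toHomeo : OpenPartialHomeomorph ((𝕊 1) × (𝔼 2)) X := ν.isOpenEmbedding.toOpenPartialHomeomorph _

/-- The partial homeomorphism of `ν` is `ν` as a function. [folklore] -/
@[simp] theorem toHomeo_apply (q : (𝕊 1) × (𝔼 2)) : ν.toHomeo q = ν.toFun q := rfl

/-- The partial homeomorphism of `ν` is defined everywhere. [folklore] -/
@[simp] theorem toHomeo_source : ν.toHomeo.source = univ := by simp [toHomeo]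

/-- The target of the partial homeomorphism of `ν` is the (open) range of `ν`. [folklore] -/
@[simp] theorem toHomeo_target : ν.toHomeo.target = range ν.toFun := by simp [toHomeo]

/-- The inverse of the partial homeomorphism of `ν` is a left inverse of `ν`. [folklore] -/
theorem toHomeo_symm_apply (q : (𝕊 1) × (𝔼 2)) : ν.toHomeo.symm (ν.toFun q) = q :=
  ν.isOpenEmbedding.toOpenPartialHomeomorph_left_inv

/-- **The inverse of a tube is smooth on its range** (`contMDiffOn_symm_of_isSmoothEmbedding`).
[folklore] -/
theorem contMDiffOn_toHomeo_symm :
    ContMDiffOn (𝓡 3) ((𝓡 1).prod 𝓘(ℝ, 𝔼 2)) ∞ ν.toHomeo.symm (range ν.toFun) :=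
  contMDiffOn_symm_of_isSmoothEmbedding ν.isSmoothEmbedding ν.isOpenEmbedding

/-! #### The polar maps -/

/-- The **polar map** `(u, w) ↦ (‖w‖ • u, w / ‖w‖) : 𝕊¹ × ℝ² → ℝ² × 𝕊¹` (junk second component at
`w = 0`), the coordinate change of the surgery gluing: it exchanges the core direction `u` and the
fibre direction `w / ‖w‖`, keeping the radius. [folklore] -/
def polar (q : (𝕊 1) × (𝔼 2)) : (𝔼 2) × (𝕊 1) := (‖q.2‖ • (q.1 : 𝔼 2), radialProjection (spherePt 1) q.2)

/-- The **inverse polar map** `(z, v) ↦ (z / ‖z‖, ‖z‖ • v) : ℝ² × 𝕊¹ → 𝕊¹ × ℝ²` (junk first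
component at `z = 0`). [folklore] -/
def polarInv (p : (𝔼 2) × (𝕊 1)) : (𝕊 1) × (𝔼 2) :=
  (radialProjection (spherePt 1) p.1, ‖p.1‖ • (p.2 : 𝔼 2))

/-- `polarInv ∘ polar = id` off the zero section. [folklore] -/
theorem polarInv_polar {q : (𝕊 1) × (𝔼 2)} (hq : q.2 ≠ 0) : polarInv (polar q) = q := by
  obtain ⟨u, w⟩ := q
  simp only [polar, polarInv] at hq ⊢
  rw [radialProjection_smul _ (norm_pos_iff.2 hq), norm_smul_coe_sphere (norm_nonneg _),
    norm_smul_coe_radialProjection]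

/-- `polar ∘ polarInv = id` off the core circle `{0} × 𝕊¹`. [folklore] -/
theorem polar_polarInv {p : (𝔼 2) × (𝕊 1)} (hp : p.1 ≠ 0) : polar (polarInv p) = p := by
  obtain ⟨z, v⟩ := p
  simp only [polar, polarInv] at hp ⊢
  rw [norm_smul_coe_sphere (norm_nonneg _), norm_smul_coe_radialProjection,
    radialProjection_smul _ (norm_pos_iff.2 hp)]

/-- The disc coordinate of `polar (u, w)` has norm `‖w‖`. [folklore] -/
theorem norm_polar_fst (q : (𝕊 1) × (𝔼 2)) : ‖(polar q).1‖ = ‖q.2‖ := by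
  simp [polar, norm_smul_coe_sphere (norm_nonneg _)]

/-- `polarInv` of a point off the core circle is off the zero section. [folklore] -/
theorem polarInv_snd_ne_zero {p : (𝔼 2) × (𝕊 1)} (hp : p.1 ≠ 0) : (polarInv p).2 ≠ 0 := by
  simp only [polarInv, ne_eq, smul_eq_zero, norm_eq_zero, hp, false_or]
  exact ne_zero_of_mem_unit_sphere p.2

/-- The fibre coordinate of `polarInv (z, v)` has norm `‖z‖`. [folklore] -/
theorem norm_polarInv_snd (p : (𝔼 2) × (𝕊 1)) : ‖(polarInv p).2‖ = ‖p.1‖ := by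
  simp [polarInv, norm_smul_coe_sphere (norm_nonneg _)]

/-- The polar map is smooth away from the zero section. [folklore] -/
theorem contMDiffOn_polar :
    ContMDiffOn ((𝓡 1).prod 𝓘(ℝ, 𝔼 2)) (𝓘(ℝ, 𝔼 2).prod (𝓡 1)) ∞ polar {q | q.2 ≠ 0} := by
  refine ContMDiffOn.prodMk ?_ ?_
  · intro q hq
    have h1 : ContMDiffAt ((𝓡 1).prod 𝓘(ℝ, 𝔼 2)) 𝓘(ℝ, ℝ) ∞ (fun q : (𝕊 1) × (𝔼 2) ↦ ‖q.2‖) q :=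
      (contDiffAt_norm ℝ hq).comp_contMDiffAt contMDiffAt_snd
    have h2 : ContMDiffAt ((𝓡 1).prod 𝓘(ℝ, 𝔼 2)) 𝓘(ℝ, 𝔼 2) ∞
        (fun q : (𝕊 1) × (𝔼 2) ↦ ((q.1 : 𝕊 1) : 𝔼 2)) q :=
      (contMDiff_coe_sphere (E := 𝔼 2) (n := 1)).contMDiffAt.comp q contMDiffAt_fst
    exact ((contDiff_fst (E := ℝ) (F := 𝔼 2).smul contDiff_snd).contDiffAt.comp_contMDiffAt
      (h1.prodMk_space h2)).contMDiffWithinAt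
  · exact (contMDiffOn_radialProjection _).comp contMDiff_snd.contMDiffOn fun q hq ↦ hq

/-- The inverse polar map is smooth away from `z = 0`. [folklore] -/
theorem contMDiffOn_polarInv :
    ContMDiffOn (𝓘(ℝ, 𝔼 2).prod (𝓡 1)) ((𝓡 1).prod 𝓘(ℝ, 𝔼 2)) ∞ polarInv {p | p.1 ≠ 0} := by
  refine ContMDiffOn.prodMk ?_ ?_
  · exact (contMDiffOn_radialProjection _).comp contMDiff_fst.contMDiffOn fun p hp ↦ hp
  · intro p hp
    have h1 : ContMDiffAt (𝓘(ℝ, 𝔼 2).prod (𝓡 1)) 𝓘(ℝ, ℝ) ∞ (fun p : (𝔼 2) × (𝕊 1) ↦ ‖p.1‖) p :=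
      (contDiffAt_norm ℝ hp).comp_contMDiffAt contMDiffAt_fst
    have h2 : ContMDiffAt (𝓘(ℝ, 𝔼 2).prod (𝓡 1)) 𝓘(ℝ, 𝔼 2) ∞
        (fun p : (𝔼 2) × (𝕊 1) ↦ ((p.2 : 𝕊 1) : 𝔼 2)) p :=
      (contMDiff_coe_sphere (E := 𝔼 2) (n := 1)).contMDiffAt.comp p contMDiffAt_snd
    exact ((contDiff_fst (E := ℝ) (F := 𝔼 2).smul contDiff_snd).contDiffAt.comp_contMDiffAt
      (h1.prodMk_space h2)).contMDiffWithinAt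

/-! #### The gluing maps -/

/-- The **punctured open tube** `ν(𝕊¹ × (B² ∖ 0))`, the gluing region on the side of `X`. [folklore] -/
def puncturedTube : Set X := ν.toFun '' {q | q.2 ≠ 0 ∧ ‖q.2‖ < 1}

/-- The punctured tube is open. [folklore] -/
theorem isOpen_puncturedTube : IsOpen ν.puncturedTube := by
  refine ν.isOpenEmbedding.isOpenMap _ (IsOpen.inter ?_ ?_)
  · exact isOpen_ne.preimage continuous_snd
  · exact isOpen_lt (continuous_norm.comp continuous_snd) continuous_const

/-- The punctured tube lies in the range of `ν`. [folklore] -/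
theorem puncturedTube_subset_range : ν.puncturedTube ⊆ range ν.toFun := image_subset_range _ _

/-- `ν (u, w)` lies in the punctured tube iff `0 < ‖w‖ < 1`. [folklore] -/
theorem apply_mem_puncturedTube_iff {q : (𝕊 1) × (𝔼 2)} :
    ν.toFun q ∈ ν.puncturedTube ↔ q.2 ≠ 0 ∧ ‖q.2‖ < 1 :=
  ν.injective.mem_set_image

/-- The punctured tube misses the core circle. [folklore] -/
theorem puncturedTube_subset_compl_range : ν.puncturedTube ⊆ (range c)ᶜ := by
  rintro _ ⟨⟨u, w⟩, ⟨hw, -⟩, rfl⟩ h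
  exact hw (ν.apply_mem_range_iff.1 h)

/-- The forward gluing map at the level of `X`: `polar ∘ ν⁻¹` (junk off `range ν`). [folklore] -/
def fwdX (x : X) : (𝔼 2) × (𝕊 1) := polar (ν.toHomeo.symm x)

/-- The backward gluing map at the level of `ℝ² × 𝕊¹`: `ν ∘ polarInv`. [folklore] -/
def bwdX (p : (𝔼 2) × (𝕊 1)) : X := ν.toFun (polarInv p)

/-- On the range of `ν`, the forward map is `polar ∘ ν⁻¹`. [folklore] -/
theorem fwdX_apply (q : (𝕊 1) × (𝔼 2)) : ν.fwdX (ν.toFun q) = polar q := by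
  rw [fwdX, toHomeo_symm_apply]

/-- The forward map `polar ∘ ν⁻¹` is smooth on the punctured tube. [folklore] -/
theorem contMDiffOn_fwdX :
    ContMDiffOn (𝓡 3) (𝓘(ℝ, 𝔼 2).prod (𝓡 1)) ∞ ν.fwdX ν.puncturedTube := by
  refine contMDiffOn_polar.comp (ν.contMDiffOn_toHomeo_symm.mono ν.puncturedTube_subset_range) ?_
  rintro _ ⟨q, hq, rfl⟩
  simp only [mem_preimage, toHomeo_symm_apply, mem_setOf_eq]
  exact hq.1

/-- The backward map `ν ∘ polarInv` is smooth off the core circle of the solid torus. [folklore] -/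
theorem contMDiffOn_bwdX :
    ContMDiffOn (𝓘(ℝ, 𝔼 2).prod (𝓡 1)) (𝓡 3) ∞ ν.bwdX {p | p.1 ≠ 0} :=
  ν.contMDiff.comp_contMDiffOn contMDiffOn_polarInv

/-- A base point of `D̊² × 𝕊¹` (junk value). [folklore] -/
def basePtB : ↥solidTorus := ⟨((0 : 𝔼 2), spherePt 1), by simp [mem_solidTorus_iff]⟩

/-- A fixed nonzero vector of norm `1/2` in `ℝ²`. [folklore] -/
def halfVec : 𝔼 2 := (2 : ℝ)⁻¹ • EuclideanSpace.single 0 1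

/-- `halfVec ≠ 0`. [folklore] -/
theorem halfVec_ne_zero : halfVec ≠ 0 := by
  simp [halfVec]

/-- The forward gluing map `X → D̊² × 𝕊¹` (values in the open piece; junk where undefined). [folklore] -/
def fwdB (x : X) : ↥solidTorus := by
  classical
  exact if h : ν.fwdX x ∈ solidTorus then ⟨ν.fwdX x, h⟩ else basePtB

/-- The forward map sends `ν (u, w)`, `‖w‖ < 1`, into `D̊² × 𝕊¹`. [folklore] -/
theorem fwdX_mem_solidTorus {q : (𝕊 1) × (𝔼 2)} (hq : ‖q.2‖ < 1) :
    ν.fwdX (ν.toFun q) ∈ solidTorus := by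
  rw [fwdX_apply, mem_solidTorus_iff, norm_polar_fst]; exact hq

/-- The forward map into `D̊² × 𝕊¹` on the tube of radius `1` is `polar`. [folklore] -/
theorem coe_fwdB_apply {q : (𝕊 1) × (𝔼 2)} (hq : ‖q.2‖ < 1) :
    (ν.fwdB (ν.toFun q) : (𝔼 2) × (𝕊 1)) = polar q := by
  rw [fwdB, dif_pos (ν.fwdX_mem_solidTorus hq), Subtype.coe_mk, fwdX_apply]

variable [T2Space X]

/-- A base point of `X ∖ c(𝕊¹)` (junk value): `ν (e₀, w₀)` with `w₀ ≠ 0`. [folklore] -/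
def basePtA : ↥ν.complement :=
  ⟨ν.toFun (spherePt 1, halfVec), by
    rw [TubeNbhd.mem_complement_iff, ν.apply_mem_range_iff]; exact halfVec_ne_zero⟩

/-- The backward gluing map `ℝ² × 𝕊¹ → X ∖ c(𝕊¹)` (junk where undefined). [folklore] -/
def bwdA (p : (𝔼 2) × (𝕊 1)) : ↥ν.complement := by
  classical
  exact if h : ν.bwdX p ∈ ν.complement then ⟨ν.bwdX p, h⟩ else ν.basePtA

/-- The backward map lands in the complement of the core circle off the core of the solid torus.
[folklore] -/
theorem bwdX_mem_complement {p : (𝔼 2) × (𝕊 1)} (hp : p.1 ≠ 0) : ν.bwdX p ∈ ν.complement := by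
  rw [TubeNbhd.mem_complement_iff, bwdX, polarInv]
  rw [ν.apply_mem_range_iff]
  exact polarInv_snd_ne_zero hp

/-- The backward map into `X ∖ c` off the core of the solid torus is `ν ∘ polarInv`. [folklore] -/
theorem coe_bwdA_apply {p : (𝔼 2) × (𝕊 1)} (hp : p.1 ≠ 0) :
    (ν.bwdA p : X) = ν.toFun (polarInv p) := by
  rw [bwdA, dif_pos (ν.bwdX_mem_complement hp)]; rfl

/-- The forward gluing map is smooth on the punctured tube (as a map into the open piece
`D̊² × 𝕊¹`). [folklore] -/
theorem contMDiffOn_fwdB :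
    ContMDiffOn (𝓡 3) (𝓘(ℝ, 𝔼 2).prod (𝓡 1)) ∞ (fun a : ↥ν.complement ↦ ν.fwdB a)
      {a | (a : X) ∈ ν.puncturedTube} := by
  intro a ha
  refine (contMDiffAt_subtype_iff.2 ?_).contMDiffWithinAt
  rw [← ContMDiffAt.subtypeVal_comp_iff]
  have hev : (Subtype.val ∘ fun y ↦ ν.fwdB y) =ᶠ[𝓝 (a : X)] ν.fwdX := by
    filter_upwards [ν.isOpen_puncturedTube.mem_nhds ha]
    rintro _ ⟨q, hq, rfl⟩
    simp only [Function.comp_apply]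
    rw [ν.coe_fwdB_apply hq.2, fwdX_apply]
  exact ((ν.contMDiffOn_fwdX.contMDiffAt (ν.isOpen_puncturedTube.mem_nhds ha)).congr_of_eventuallyEq
    hev)

/-- The backward gluing map is smooth off `z = 0` (as a map into the open piece `X ∖ c`). [folklore] -/
theorem contMDiffOn_bwdA :
    ContMDiffOn (𝓘(ℝ, 𝔼 2).prod (𝓡 1)) (𝓡 3) ∞ (fun b : ↥solidTorus ↦ ν.bwdA b)
      {b | (b : (𝔼 2) × (𝕊 1)).1 ≠ 0} := by
  intro b hb
  refine (contMDiffAt_subtype_iff.2 ?_).contMDiffWithinAt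
  rw [← ContMDiffAt.subtypeVal_comp_iff]
  have ho : IsOpen {p : (𝔼 2) × (𝕊 1) | p.1 ≠ 0} := isOpen_ne.preimage continuous_fst
  have hev : (Subtype.val ∘ fun y ↦ ν.bwdA y) =ᶠ[𝓝 (b : (𝔼 2) × (𝕊 1))] ν.bwdX := by
    filter_upwards [ho.mem_nhds hb] with p hp
    simp only [Function.comp_apply]
    rw [ν.coe_bwdA_apply hp]; rfl
  exact (ν.contMDiffOn_bwdX.contMDiffAt (ho.mem_nhds hb)).congr_of_eventuallyEq hev

/-- **The gluing partial diffeomorphism of a tube surgery**: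
`ν(u, w) ↦ (‖w‖ • u, w / ‖w‖)` from the punctured tube `ν(𝕊¹ × (B² ∖ 0)) ⊆ X ∖ c` onto
`(D̊² ∖ 0) × 𝕊¹ ⊆ D̊² × 𝕊¹` (Rolfsen (1976), §9.F; Gompf–Stipsicz (1999), §5.3). [folklore] -/
def glue : OpenPartialHomeomorph (↥ν.complement) (↥solidTorus) where
  toFun a := ν.fwdB a
  invFun b := ν.bwdA b
  source := {a : ↥ν.complement | (a : X) ∈ ν.puncturedTube}
  target := {b : ↥solidTorus | (b : (𝔼 2) × (𝕊 1)).1 ≠ 0}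
  map_source' := by
    rintro ⟨_, ha'⟩ ⟨q, hq, rfl⟩
    show (ν.fwdB (ν.toFun q) : (𝔼 2) × (𝕊 1)).1 ≠ 0
    rw [ν.coe_fwdB_apply hq.2, ← norm_ne_zero_iff, norm_polar_fst, norm_ne_zero_iff]
    exact hq.1
  map_target' := by
    intro b hb
    show (ν.bwdA b : X) ∈ ν.puncturedTube
    rw [ν.coe_bwdA_apply hb, apply_mem_puncturedTube_iff, norm_polarInv_snd]
    exact ⟨polarInv_snd_ne_zero hb, (mem_solidTorus_iff _).1 b.2⟩
  left_inv' := by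
    rintro ⟨_, ha'⟩ ⟨q, hq, rfl⟩
    ext1
    have h1 : (ν.fwdB (ν.toFun q) : (𝔼 2) × (𝕊 1)).1 ≠ 0 := by
      rw [ν.coe_fwdB_apply hq.2, ← norm_ne_zero_iff, norm_polar_fst, norm_ne_zero_iff]; exact hq.1
    show (ν.bwdA (ν.fwdB (ν.toFun q)) : X) = ν.toFun q
    rw [ν.coe_bwdA_apply h1, ν.coe_fwdB_apply hq.2, polarInv_polar hq.1]
  right_inv' := by
    intro b hb
    ext1
    show (ν.fwdB (ν.bwdA b) : (𝔼 2) × (𝕊 1)) = b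
    rw [ν.coe_bwdA_apply hb, ν.coe_fwdB_apply (by rw [norm_polarInv_snd]; exact (mem_solidTorus_iff _).1 b.2),
      polar_polarInv hb]
  open_source := ν.isOpen_puncturedTube.preimage continuous_subtype_val
  open_target := (isOpen_ne.preimage continuous_fst).preimage continuous_subtype_val
  continuousOn_toFun := ν.contMDiffOn_fwdB.continuousOn
  continuousOn_invFun := ν.contMDiffOn_bwdA.continuousOn

/-- The source of the gluing map is the punctured tube. [folklore] -/
theorem glue_source : ν.glue.source = {a : ↥ν.complement | (a : X) ∈ ν.puncturedTube} := rfl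

/-- The target of the gluing map is the complement of the core circle of the solid torus. [folklore] -/
theorem glue_target : ν.glue.target = {b : ↥solidTorus | (b : (𝔼 2) × (𝕊 1)).1 ≠ 0} := rfl

/-- The gluing map is the forward map. [folklore] -/
theorem glue_apply (a : ↥ν.complement) : ν.glue a = ν.fwdB a := rfl

/-- The inverse gluing map is the backward map. [folklore] -/
theorem glue_symm_apply (b : ↥solidTorus) : ν.glue.symm b = ν.bwdA b := rfl

/-- The identification `ℝ² × ℝ¹ ≃L ℝ³` of the model vector spaces (equal dimension). [folklore] -/
def linB : ((𝔼 2) × (𝔼 1)) ≃L[ℝ] 𝔼 3 :=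
  ContinuousLinearEquiv.ofFinrankEq (by simp)

/-- **The gluing datum of a tube surgery** along the tube `ν`. [folklore] -/
def glueData : SmoothGlueData (𝓡 3) (𝓘(ℝ, 𝔼 2).prod (𝓡 1)) (↥ν.complement) (↥solidTorus) (𝔼 3) where
  glue := ν.glue
  contMDiffOn_glue := ν.contMDiffOn_fwdB
  contMDiffOn_glue_symm := ν.contMDiffOn_bwdA
  linA := ContinuousLinearEquiv.refl ℝ (𝔼 3)
  linB := linB

/-- The gluing map of the surgery datum is `ν.glue`. [folklore] -/
@[simp] theorem glueData_glue : ν.glueData.glue = ν.glue := rfl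

/-- **The gluing datum realises `tubeSurgeryRel`.** [folklore] -/
theorem tubeSurgeryRel_iff (a : ↥ν.complement) (b : ↥solidTorus) :
    tubeSurgeryRel ν a b ↔ a ∈ ν.glueData.glue.source ∧ ν.glueData.glue a = b := by
  change tubeSurgeryRel ν a b ↔ (a : X) ∈ ν.puncturedTube ∧ ν.fwdB a = b
  constructor
  · rintro ⟨u, t, ht, hb1, ha⟩
    have hq : ((u, t • ((b : (𝔼 2) × (𝕊 1)).2 : 𝔼 2)) : (𝕊 1) × (𝔼 2)).2 ≠ 0 ∧
        ‖((u, t • ((b : (𝔼 2) × (𝕊 1)).2 : 𝔼 2)) : (𝕊 1) × (𝔼 2)).2‖ < 1 := by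
      simp only [norm_smul_coe_sphere ht.1.le, ne_eq, smul_eq_zero, ht.1.ne', false_or]
      exact ⟨ne_zero_of_mem_unit_sphere _, ht.2⟩
    refine ⟨ha ▸ (ν.apply_mem_puncturedTube_iff.2 hq), ?_⟩
    ext1
    rw [ha, ν.coe_fwdB_apply hq.2, polar]
    ext1
    · simp only [norm_smul_coe_sphere ht.1.le]; exact hb1.symm
    · exact radialProjection_smul _ ht.1 _
  · rintro ⟨⟨⟨u, w⟩, ⟨hw0, hw1⟩, ha⟩, hb⟩
    refine ⟨u, ‖w‖, ⟨norm_pos_iff.2 hw0, hw1⟩, ?_, ?_⟩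
    · rw [← hb, ← ha, ν.coe_fwdB_apply hw1, polar]
    · rw [← hb, ← ha, ν.coe_fwdB_apply hw1, polar]
      simp only
      rw [norm_smul_coe_radialProjection]

/-- The parametrisation `(u, t, v) ↦ (ν(u, t • v), (t • u, v))` of the closure of the graph of the
gluing map by the compact space `𝕊¹ × [0, 1] × 𝕊¹`. [folklore] -/
def graphParam (r : (𝕊 1) × (Icc (0 : ℝ) 1) × (𝕊 1)) : X × ((𝔼 2) × (𝕊 1)) :=
  (ν.toFun (r.1, (r.2.1 : ℝ) • (r.2.2 : 𝔼 2)), ((r.2.1 : ℝ) • (r.1 : 𝔼 2), r.2.2))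

omit [T2Space X] in
/-- The parametrisation of the closure of the graph is continuous. [folklore] -/
theorem continuous_graphParam : Continuous ν.graphParam := by
  unfold graphParam
  have := ν.isOpenEmbedding.continuous
  fun_prop

/-- **The graph of the gluing map is closed** in `(X ∖ c) × (D̊² × 𝕊¹)`: it is the trace of the
compact set `graphParam (𝕊¹ × [0,1] × 𝕊¹)`, whose extra points (`t = 0`: on the core circle;
`t = 1`: on `∂D² × 𝕊¹`) lie outside the two open pieces. This is the Hausdorff condition of the
surgery pushout ("Hausdorff since both core circles are removed", `Literature.Topology.FourManifolds.exists_isIntegralSurgery`).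
[folklore] -/
theorem isClosed_graph : IsClosed {p : ↥ν.complement × ↥solidTorus |
    p.1 ∈ ν.glueData.glue.source ∧ ν.glueData.glue p.1 = p.2} := by
  have hc : IsClosed (range ν.graphParam) :=
    (isCompact_range ν.continuous_graphParam).isClosed
  have hcont : Continuous fun p : ↥ν.complement × ↥solidTorus ↦
      ((p.1 : X), (p.2 : (𝔼 2) × (𝕊 1))) := by fun_prop
  convert hc.preimage hcont using 1
  ext ⟨a, b⟩
  rw [mem_setOf_eq, ← tubeSurgeryRel_iff]
  simp only [mem_preimage, mem_range]
  constructor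
  · rintro ⟨u, t, ht, hb1, ha⟩
    refine ⟨(u, ⟨t, ht.1.le, ht.2.le⟩, (b : (𝔼 2) × (𝕊 1)).2), ?_⟩
    simp only [graphParam, Prod.mk.injEq]
    exact ⟨ha.symm, Prod.ext hb1.symm rfl⟩
  · rintro ⟨⟨u, ⟨t, ht0, ht1⟩, v⟩, h⟩
    simp only [graphParam, Prod.mk.injEq] at h
    obtain ⟨ha, hb⟩ := h
    have ht0' : 0 < t := by
      rcases ht0.lt_or_eq with h | rfl
      · exact h
      · exfalso
        have : (a : X) ∈ range c := by rw [← ha, ν.apply_mem_range_iff]; simp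
        exact a.2 this
    have ht1' : t < 1 := by
      rcases ht1.lt_or_eq with h | rfl
      · exact h
      · exfalso
        have hb2 := b.2
        rw [mem_solidTorus_iff, ← hb] at hb2
        simp at hb2
    refine ⟨u, t, ⟨ht0', ht1'⟩, ?_, ?_⟩
    · rw [← hb]
    · rw [← ha, ← hb]

/-- The compact set `X ∖ ν(𝕊¹ × ½B²)`, seen in `X ∖ c`. [folklore] -/
def cptA : Set ↥ν.complement := {a | (a : X) ∉ ν.toFun '' {q | ‖q.2‖ < 2⁻¹}}

/-- The compact set `½D² × 𝕊¹`, seen in `D̊² × 𝕊¹`. [folklore] -/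
def cptB : Set ↥solidTorus := {b | ‖(b : (𝔼 2) × (𝕊 1)).1‖ ≤ 2⁻¹}

/-- `X ∖ ν(𝕊¹ × ½B²)` is compact (for compact `X`). [folklore] -/
theorem isCompact_cptA [CompactSpace X] : IsCompact ν.cptA := by
  have hopen : IsOpen (ν.toFun '' {q : (𝕊 1) × (𝔼 2) | ‖q.2‖ < 2⁻¹}) :=
    ν.isOpenEmbedding.isOpenMap _ (isOpen_lt (continuous_norm.comp continuous_snd) continuous_const)
  refine Topology.IsInducing.subtypeVal.isCompact_preimage' hopen.isClosed_compl.isCompact ?_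
  intro x hx
  refine ⟨⟨x, ?_⟩, rfl⟩
  show x ∈ (Set.range c)ᶜ
  rintro ⟨u, rfl⟩
  exact hx ⟨(u, 0), by simp, ν.apply_zero u⟩

omit [T2Space X] in
/-- `½D² × 𝕊¹` is compact. [folklore] -/
theorem isCompact_cptB : IsCompact cptB := by
  have h : cptB = ((↑) : ↥solidTorus → (𝔼 2) × (𝕊 1)) ⁻¹' (closedBall (0 : 𝔼 2) 2⁻¹ ×ˢ univ) := by
    ext b; simp [cptB]
  rw [h]
  refine Topology.IsInducing.subtypeVal.isCompact_preimage'
    ((isCompact_closedBall _ _).prod isCompact_univ) ?_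
  rintro ⟨z, v⟩ ⟨hz, -⟩
  rw [mem_closedBall, dist_zero_right] at hz
  have hz' : ((z, v) : (𝔼 2) × (𝕊 1)) ∈ solidTorus := by
    rw [mem_solidTorus_iff]; exact hz.trans_lt (by norm_num)
  exact ⟨⟨(z, v), hz'⟩, rfl⟩

/-- A point of `X ∖ c` outside `X ∖ ν(𝕊¹ × ½B²)` is glued to a point of `½D² × 𝕊¹`. [folklore] -/
theorem forall_not_mem_cptA (a : ↥ν.complement) (ha : a ∉ ν.cptA) :
    a ∈ ν.glue.source ∧ ν.glue a ∈ cptB := by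
  simp only [cptA, mem_setOf_eq, not_not] at ha
  obtain ⟨⟨u, w⟩, hw, hwa⟩ := ha
  have hw' : ‖w‖ < 2⁻¹ := hw
  have hw0 : w ≠ 0 := by
    rintro rfl
    exact a.2 ⟨u, by rw [← hwa, ν.apply_zero]⟩
  have hw1 : ‖w‖ < 1 := hw'.trans (by norm_num)
  constructor
  · rw [glue_source, mem_setOf_eq, ← hwa, apply_mem_puncturedTube_iff]
    exact ⟨hw0, hw1⟩
  · rw [cptB, mem_setOf_eq, glue_apply]
    have : (ν.fwdB a : (𝔼 2) × (𝕊 1)) = polar (u, w) := by rw [← hwa]; exact ν.coe_fwdB_apply hw1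
    rw [this, norm_polar_fst]
    exact hw'.le

/-- A point of `D̊² × 𝕊¹` outside `½D² × 𝕊¹` is glued to a point of `X ∖ ν(𝕊¹ × ½B²)`. [folklore] -/
theorem forall_not_mem_cptB (b : ↥solidTorus) (hb : b ∉ cptB) :
    b ∈ ν.glue.target ∧ ν.glue.symm b ∈ ν.cptA := by
  simp only [cptB, mem_setOf_eq, not_le] at hb
  have hb0 : (b : (𝔼 2) × (𝕊 1)).1 ≠ 0 := by
    rw [← norm_pos_iff]; exact hb.trans' (by norm_num)
  refine ⟨hb0, ?_⟩
  rw [cptA, mem_setOf_eq, glue_symm_apply, ν.coe_bwdA_apply hb0, ν.injective.mem_set_image]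
  simp only [mem_setOf_eq, norm_polarInv_snd, not_lt]
  exact hb.le

variable [IsManifold (𝓡 3) ∞ X]

/-- **The surgered manifold** `X' = (X ∖ ν(𝕊¹ × B²)) ∪_{𝕊¹ × 𝕊¹} (D² × 𝕊¹)` of the tube `ν` —
"a solid torus removed and sewn back differently" (Lickorish (1962), Thm. 2), as the glued space
of the surgery gluing datum (Rolfsen (1976), §9.F). [cite: Rolfsen1976, §9.F] -/
abbrev Surgered : Type u := ν.glueData.Glued

/-- The surgered manifold is Hausdorff (closed graph of the gluing map). [folklore] -/
instance t2Space_surgered : T2Space ν.Surgered := ν.glueData.t2Space_of_isClosed_graph ν.isClosed_graph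

/-- The surgered manifold of a compact manifold is compact. [folklore] -/
instance compactSpace_surgered [CompactSpace X] : CompactSpace ν.Surgered :=
  ν.glueData.compactSpace_of_forall_not_mem ν.isCompact_cptA isCompact_cptB ν.forall_not_mem_cptA
    ν.forall_not_mem_cptB

/-- The surgered manifold of a compact manifold is second countable. [folklore] -/
instance secondCountable_surgered [CompactSpace X] : SecondCountableTopology ν.Surgered :=
  ν.glueData.secondCountableTopology

/-- The surgered manifold is an open gluing of `X ∖ c` and `D̊² × 𝕊¹` along `tubeSurgeryRel ν`,
with the explicit witnesses `inl`, `inr` of the pushout. [folklore] -/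
theorem isOpenGluingWith_surgered :
    IsOpenGluingWith (𝓡 3) (𝓘(ℝ, 𝔼 2).prod (𝓡 1)) (𝓡 3) (A := ↥ν.complement) (B := ↥solidTorus)
      (P := ν.Surgered) (tubeSurgeryRel ν) ν.glueData.inl ν.glueData.inr :=
  ν.glueData.isOpenGluingWith ν.tubeSurgeryRel_iff

/-- The surgered manifold is an open gluing of `X ∖ c` and `D̊² × 𝕊¹` along `tubeSurgeryRel ν`. [folklore] -/
theorem isOpenGluing_surgered :
    IsOpenGluing (𝓡 3) (𝓘(ℝ, 𝔼 2).prod (𝓡 1)) (𝓡 3) (A := ↥ν.complement) (B := ↥solidTorus)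
      (P := ν.Surgered) (tubeSurgeryRel ν) :=
  ν.glueData.isOpenGluing ν.tubeSurgeryRel_iff

end TubeNbhd

end Datum

/-! ### Existence statements -/

/-- **Dehn surgery along a tube exists, with explicit gluing maps**: for a tube `ν` around a circle
`c` in a closed smooth 3-manifold `X` there is a closed (compact, Hausdorff, second countable)
smooth 3-manifold `P` with open smooth embeddings `jA : X ∖ c ↪ P`, `jB : D̊² × 𝕊¹ ↪ P` exhibiting
`P` as the open gluing of `X ∖ c` and `D̊² × 𝕊¹` along `tubeSurgeryRel ν` — the pushout
`(X ∖ c) ∪_glue (D̊² × 𝕊¹)` (`TubeNbhd.Surgered`). Rolfsen (1976), §9.F; Lickorish (1962), proof of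
Thm. 2 ("cutting a solid torus out ... and having to sew it back differently").
[cite: Rolfsen1976, §9.F] -/
theorem TubeNbhd.surgery_exists_with {X : Type u} [TopologicalSpace X] [T2Space X]
    [SecondCountableTopology X] [CompactSpace X] [ChartedSpace (𝔼 3) X] [IsManifold (𝓡 3) ∞ X]
    {c : 𝕊 1 → X} (ν : TubeNbhd (𝓡 3) c) :
    ∃ (P : Type u) (_ : TopologicalSpace P) (_ : T2Space P) (_ : SecondCountableTopology P)
      (_ : ChartedSpace (𝔼 3) P) (_ : IsManifold (𝓡 3) ∞ P) (_ : CompactSpace P)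
      (jA : ↥ν.complement → P) (jB : ↥solidTorus → P),
      IsOpenGluingWith (𝓡 3) (𝓘(ℝ, 𝔼 2).prod (𝓡 1)) (𝓡 3) (A := ↥ν.complement) (B := ↥solidTorus)
        (P := P) (tubeSurgeryRel ν) jA jB :=
  ⟨ν.Surgered, inferInstance, inferInstance, inferInstance, inferInstance, inferInstance,
    inferInstance, _, _, ν.isOpenGluingWith_surgered⟩

/-- **Dehn surgery along a tube exists**: for a tube `ν` around a circle `c` in a closed smooth
3-manifold `X` there is a closed smooth 3-manifold which is an open gluing of `X ∖ c` and
`D̊² × 𝕊¹` along `tubeSurgeryRel ν`. Rolfsen (1976), §9.F. [cite: Rolfsen1976, §9.F] -/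
theorem TubeNbhd.surgery_exists {X : Type u} [TopologicalSpace X] [T2Space X]
    [SecondCountableTopology X] [CompactSpace X] [ChartedSpace (𝔼 3) X] [IsManifold (𝓡 3) ∞ X]
    {c : 𝕊 1 → X} (ν : TubeNbhd (𝓡 3) c) :
    ∃ (P : Type u) (_ : TopologicalSpace P) (_ : T2Space P) (_ : SecondCountableTopology P)
      (_ : ChartedSpace (𝔼 3) P) (_ : IsManifold (𝓡 3) ∞ P) (_ : CompactSpace P),
      IsOpenGluing (𝓡 3) (𝓘(ℝ, 𝔼 2).prod (𝓡 1)) (𝓡 3) (A := ↥ν.complement) (B := ↥solidTorus)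
        (P := P) (tubeSurgeryRel ν) :=
  ⟨ν.Surgered, inferInstance, inferInstance, inferInstance, inferInstance, inferInstance,
    inferInstance, ν.isOpenGluing_surgered⟩

/-- **Existence of Dehn surgery on a knot in `S³` from a framed tubular neighbourhood**: the named
fact `Literature.Topology.FourManifolds.exists_isIntegralSurgery` of `DehnSurgery.lean` (for every knot `K` and integer `m`,
`m`-surgery on `K` exists as a closed smooth 3-manifold) follows from the existence of an
oriented tubular neighbourhood of framing `m` (`Literature.Topology.FourManifolds.Knot.exists_tubularNbhd_hasFraming`, the
remaining hypothesis) by surgery along its tube (`TubeNbhd.surgery_exists`; the surgery relation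
is `surgeryRel ν` by `tubeSurgeryRel_toTubeNbhd`). Rolfsen (1976), §9.F; Gompf–Stipsicz (1999),
§5.3. [cite: GompfStipsicz1999, §5.3] -/
theorem exists_isIntegralSurgery_of (h : Knot.exists_tubularNbhd_hasFraming) :
    exists_isIntegralSurgery := by
  intro K m
  obtain ⟨ν, hν⟩ := h K m
  obtain ⟨P, _, _, _, _, _, _, hP⟩ := ν.toTubeNbhd.surgery_exists
  refine ⟨P, ‹_›, ‹_›, ‹_›, ‹_›, ‹_›, ‹_›, ν, hν, ?_⟩
  exact hP

end Literature.Topology.FourManifolds
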